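import Literature.NumberTheory.EllipticCurves.GaussianLatticeThirdValues
import Literature.NumberTheory.EllipticCurves.GaussianLatticeFifthDivision
import HarnessLib

/-!
# `℘(1/3) · ℘((1+i)/3) = −i ϖ₀⁴/√3` on the Gaussian lattice — piece P4.0 of the STUB-PLAN for line `rubin_e1_inert_three`'s quartic stub

Summit `BirchSwinnertonDyer`, crux `InertBadAtThree` (stmt-BirchSwinnertonDyer-19225), line of record `Lines/rubin_e1_inert_three.lean`
(lead `bsd-line-ibd-p1` g6), registered stub `stub_plainOddNeronIntegralThreeQuartic` (the CM-side `3`-integrality of odd twisted values of the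
quartic twists `y² = x³ − Dx`, `3 ∣ D`). Ideator bsd-idea-18 g8's STUB-PLAN (`Cruxes/InertBadAtThree/STUB-PLAN-neronIntegralThreeQuartic-bsd-idea-18-g8.md`,
`QUARTIC_STUB_PLAN_bsd_idea_18_g8.lean`) cuts that stub into pieces P0–P6; this file proves its first piece **P4.0 `stub_third_mul_diag_third`**
(statement VERBATIM, with the Gaussian-lattice notations `Λᵢ = PeriodPair.ofUpperHalfPlane UpperHalfPlane.I`, `ϖ₀ = Γ(1/4)²/(2√(2π))` spelled out):

* `weierstrassP_third_ne_zero` — `℘(1/3) ≠ 0` (its square is the positive real `(3 + 2√3)ϖ₀⁴/3`, tree `GaussianLattice.weierstrassP_third_sq`);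
* **`weierstrassP_third_mul_one_add_I_third`** — `℘(1/3)·℘((1+i)/3) = −iϖ₀⁴/√3`: complex multiplication by `1 + i`
  (tree `GaussianLattice.weierstrassP_one_add_I_mul`: `℘((1+i)u) = −i(℘(u)² − ϖ₀⁴)/(2℘(u))`) at `u = 1/3`, then `℘(1/3)² = (3 + 2√3)ϖ₀⁴/3`.
  Only `℘(1/3)²` enters (sign-free). It is the constant `P₁P₂` of the plan's closed forms P4.1/P4.2 for the `χ₄`/`χ̄₄`-twisted `3`-torsion sums of `E₁*`.

Nothing about BSD, the crux or the stub is proved here beyond this identity. No definitions; axioms standard.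
-/

set_option autoImplicit false
set_option linter.dupNamespace false

noncomputable section

open Complex Real PeriodPair
open scoped Real PeriodPair

namespace Summit.BirchSwinnertonDyer.BirchSwinnertonDyer.Theorems.InertBadSignedBranchesInertBadAtThreeThirdDiagProduct

open Literature.NumberTheory.EllipticCurves

/-- **`℘(1/3) ≠ 0` on `ℤi + ℤ`**: `℘(1/3)² = (3 + 2√3)ϖ₀⁴/3 > 0`. [folklore] -/
theorem weierstrassP_third_ne_zero :
    ℘[PeriodPair.ofUpperHalfPlane UpperHalfPlane.I] (1 / 3) ≠ 0 := by
  intro h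
  have hsq := GaussianLattice.weierstrassP_third_sq
  rw [h, zero_pow two_ne_zero] at hsq
  have hpos : (0 : ℝ) < (3 + 2 * Real.sqrt 3) / 3 * (Real.Gamma (1 / 4) ^ 2 / (2 * Real.sqrt (2 * π))) ^ 4 := by
    have := GaussianLattice.varpi_pos
    positivity
  have hzero : ((3 + 2 * Real.sqrt 3) / 3 * (Real.Gamma (1 / 4) ^ 2 / (2 * Real.sqrt (2 * π))) ^ 4 : ℝ) = 0 := by
    exact_mod_cast hsq.symm
  exact hpos.ne' hzero

/-- **P4.0 — `℘(1/3) · ℘((1+i)/3) = −i ϖ₀⁴/√3`** on the Gaussian lattice `ℤi + ℤ` (`ϖ₀ = Γ(1/4)²/(2√(2π))`): complex multiplication by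
`1 + i` at `u = 1/3` and the value of `℘(1/3)²`. Numerically `10.0920153… × (−2.7041473… i) = −27.2902964… i`. [folklore] -/
theorem weierstrassP_third_mul_one_add_I_third :
    ℘[PeriodPair.ofUpperHalfPlane UpperHalfPlane.I] (1 / 3) *
        ℘[PeriodPair.ofUpperHalfPlane UpperHalfPlane.I] ((1 + I) / 3) =
      -I * ((Real.Gamma (1 / 4) ^ 2 / (2 * Real.sqrt (2 * π)) : ℝ) : ℂ) ^ 4 / (Real.sqrt 3 : ℂ) := by
  set P := ℘[PeriodPair.ofUpperHalfPlane UpperHalfPlane.I] (1 / 3) with hPdef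
  set ϖ : ℝ := Real.Gamma (1 / 4) ^ 2 / (2 * Real.sqrt (2 * π)) with hϖdef
  have hP0 : P ≠ 0 := weierstrassP_third_ne_zero
  have hsq : P ^ 2 = (((3 + 2 * Real.sqrt 3) / 3 * ϖ ^ 4 : ℝ) : ℂ) := GaussianLattice.weierstrassP_third_sq
  have hmul := GaussianLattice.weierstrassP_one_add_I_mul (u := 1 / 3) GaussianLattice.one_third_notMem hP0
  have harg : (1 + I) * (1 / 3 : ℂ) = (1 + I) / 3 := by ring
  rw [harg] at hmul
  rw [hmul, mul_div_assoc', show P * (-I * (P ^ 2 - (ϖ : ℂ) ^ 4)) = -I * (P ^ 2 - (ϖ : ℂ) ^ 4) * P by ring,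
    mul_div_mul_right _ _ hP0, hsq]
  have hs : ((Real.sqrt 3 : ℝ) : ℂ) ^ 2 = 3 := by
    rw [← Complex.ofReal_pow, Real.sq_sqrt (by norm_num)]; norm_num
  have hs0 : ((Real.sqrt 3 : ℝ) : ℂ) ≠ 0 := by
    exact_mod_cast (Real.sqrt_pos.mpr (by norm_num : (0 : ℝ) < 3)).ne'
  rw [div_eq_div_iff two_ne_zero hs0]
  push_cast
  linear_combination (-(2 : ℂ) / 3 * I * (ϖ : ℂ) ^ 4) * hs

end Summit.BirchSwinnertonDyer.BirchSwinnertonDyer.Theorems.InertBadSignedBranchesInertBadAtThreeThirdDiagProduct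

end
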